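import Mathlib
import HarnessLib
import HarnessLib.Audit
import Summits.AtomisticToContinuum.Statement
import Literature.MathematicalPhysics.QuantumManyBody.PeriodicBoseGas
import Summits.AtomisticToContinuum.BoseEinsteinCondensation.Theorems.BECFisherTransferPeriodicOccupationStability
import HarnessLib.Audit.Status.Attr

/-!
Route: BECMeanFieldControl

DORMANT since 2026-08-29T19:24:25Z (census g0: costume|duplicate of route-AtomisticToContinuum-BECNewtonPolicyIteration; reader census-reader-32-g0) — unstaffed, not closed; items shared with open routes are served there. `ledger route dormant <id> --off` reactivates.

# Route BECMeanFieldControl — −log Ψ₀ as an N-agent control value — torus BEC from a typical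
one-atom landscape bound, anchored by the O(1) mean-field-control comparison

It suffices to show X = TypicalLandscape ∧ PeriodicRigidity ∧ BoundaryTransferWeak on the TORUS of
side L = (N/ρ)^(1/3) (card
mfc-convergence-rate-log-groundstate, its hinge K1/K2 + P1 in the form that survives the
thermodynamic limit; see Why this line for what
was dropped). TypicalLandscape (the one-atom displacement comparison, = "doubling the tagged
variable"): for every repulsive finite-range v,
all small ρ, some C = C(v,ρ) and all large N = n+1, for every δ > 0 there is a NONNEGATIVE periodic
δ-near-minimiser Ψ such that relocating
a Ψ²-typical boson to a uniformly random point of the cell lowers the amplitude by at most e^(−C)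
off an exceptional set of
(Ψ²dX ⊗ L⁻³dy)-mass ≤ 1/2: (Ψ²⊗unif){(x,Y,y) : Ψ(y,Y) < e^(−C)Ψ(x,Y)} ≤ 1/2 — a ONE-SIDED, TYPICAL
vacancy principle for log Ψ₀; it gives
⟨φ₀,γ_Ψφ₀⟩ ≥ e^(−C)N/2 in two lines (support LandscapeToCondensate). PeriodicRigidity: periodic
δ-near-minimisers are mutually L²(cell)-close up
to a phase as δ → 0 (unique positive ground state + gap at fixed N), so the bound passes to EVERY
near-minimiser (support
PeriodicOccupationStability), i.e. the body of PeriodicBEC (stmt-AtomisticToContinuum-0826) for each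
v; BoundaryTransferWeak (shared item
stmt-AtomisticToContinuum-0827 of route BECPeriodicReduction, verbatim) turns it into the Dirichlet,
mode-free conjunct. The card's imported
engine is filed as the ANCHOR crux MeanFieldCorner (its K3, made precise): in Kac/mean-field scaling
(unit torus, pair potential w/N, ŵ ≥ 0
smooth) −log Ψ₀⁽ᴺ⁾(X) = N·𝒰(μ_X) + c_N + O(1) in SUP norm for ONE N-independent functional 𝒰 of the
empirical measure, Lipschitz for the
bounded-Lipschitz (W₁) metric — the image on the Bose side of the O(1/N) convergence rate for
mean-field control with convex regular data.
Lean: `TypicalLandscape ∧ PeriodicRigidity ∧ BoundaryTransferWeak`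

## Assembly
Fix v admissible; ρ₀ := min of the ρ₀'s of TypicalLandscape and PeriodicRigidity; for ρ < ρ₀ get C
from TypicalLandscape; eventually in
N = n+1 (shift the rigidity filter by Filter.tendsto_add_atTop_nat): apply PeriodicRigidity with η
:= e^(−C)/16 to get δ; TypicalLandscape at
this δ gives Ψ ≥ 0 with exceptional mass ≤ L³/2, so LandscapeToCondensate gives occ₀(Ψ) ≥
(n+1)e^(−C)/2; for any δ-near-minimiser Φ rigidity
gives ‖Ψ − cΦ‖² ≤ η and PeriodicOccupationStability gives occ₀(Φ)^(1/2) ≥ ((n+1)e^(−C)/2)^(1/2) −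
((n+1)e^(−C)/16)^(1/2), i.e. occ₀(Φ) ≥
c'(n+1) with c' = e^(−C)(1/√2 − 1/4)² > 0: this is the PeriodicBEC body for v (the hypothesis of
BoundaryTransferWeak, with sideLength ρ N,
L > 0 from 0 < ρ); BoundaryTransferWeak v hv then yields ∃ρ₀' ∀ρ HasGroundStateBEC v ρ, i.e. the
conjunct. ENNReal/rpow bookkeeping only.
MeanFieldCorner is the anchor theorem of the engine and is deliberately NOT a hypothesis of the
assembly.

Rationale: WHY THIS LINE. Dictionary (exact, Fleming–Holland log transform; for N-body Schrödinger operators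
Guerra–Morato doi:10.1103/physrevd.27.1774 and, for the
N-boson ground state as an N-agent ERGODIC control problem with McKean–Vlasov limit and convexity ⟺
v̂ ≥ 0, Albeverio–De Vecchi–Romano–Ugolini
doi:10.1137/20m1363479 = arXiv:2003.06469, Thms 5, 16, 18): Ψ₀ = e^(−U) > 0 turns HΨ₀ = E₀Ψ₀ into
the stationary HJB ΔU − |∇U|² + Σv = E₀,
U/N the per-capita value, and the imported theorem family is the CONVERGENCE PROBLEM with rate —
|V^N(x) − 𝒰(m^N_x)| ≤ C/N when 𝒰 is classical
(arXiv:1509.02505 CDLL; arXiv:2305.08423 DDJ (1.1), Thm 2.7, Prop 2.8: C/N needs convex AND regular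
data, convex d₁-Lipschitz data give only
N^(−1/d); arXiv:2312.11373) — imported from mean-field games / stochastic control (analysis on
Wasserstein space), with Lasry–Lions convexity =
Fourier positivity (Bochner). Planner's findings that shape the route: (i) the card's K1 (∃
functional 𝒰_L of the empirical measure with
sup|log Ψ₀ + N𝒰_L(μ_X)| ≤ C) is VACUOUS as stated (log Ψ₀ is symmetric, take 𝒰_L := −log Ψ₀/N), its
content being K2, and K1 ∧ K2 ⟺ a bounded
one-atom oscillation of log Ψ₀ (McShane extension); (ii) in THERMODYNAMIC scaling every sup-norm
form is false for any bounded v ≠ 0 (a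
k-cluster at the target point costs ≍ R√(k‖v‖∞) in log-amplitude, k ≤ N − 1; in mean-field scaling
clusters cost ≤ ‖w‖∞, which is why DDJ's
sup norm survives there), and a pointwise-O(1) local energy for a comparison functional Φ =
N𝒰_L(μ_X) — what "𝒰_L solves the Wasserstein HJB
to O(1/N)" means — is impossible there (extensive local-energy variance of any non-exact trial
state), so the rate theorems cannot be
imported literally at fixed density; (iii) what DOES transplant is the comparison ALONG ONE-ATOM
DISPLACEMENTS in typical form: W = U(x,Y) −
U(y,Y) solves a LINEAR Poisson equation for the bath Langevin dynamics pinned at x and y, reversible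
w.r.t. Ψ₀(x,Y)Ψ₀(y,Y)dY — the integrand
of γ(x,y) itself — with a LOCAL source Σ_j[v(x−Y_j) − v(y−Y_j)] + one-body terms, bounded iff local
perturbations of the pinned bath decay
integrably in time (t^(−3/2) in d = 3: one power to spare, none in d = 2). Hence: the hinge is typed
in exactly that one-sided typical form
(TypicalLandscape, all admissible v, torus), the engine's home ground is typed as the anchor
(MeanFieldCorner, where ŵ ≥ 0 is load-bearing:
without it the Hartree minimiser can modulate, 𝒰 is non-smooth and the total error is ≍ √N), and the
pinned-bath Poisson step is the
foreseen layer-2 child. Versus prior routes: BECPalmLandscape (Dirichlet, participation-ratio moment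
E_Q[R] ≤ C, Debye-screening engine) shares
the hinge but neither the form (one-sided displacement comparison on the torus, which tolerates
hard-core excluded volume and needs no
wall layer) nor the engine; BECRecoilCorrector / BECImpurityMassFlow type insertion residues and
pinned-scatterer overlaps (the N → N+1 and
M = ∞ channels), not the x ↔ y displacement of one boson of the symmetric ground state; no route
types the mean-field corner. Negatives
index (1 entry, BECSwapAffinity.SwapJensen refuted at n = 0 for C < 0): LandscapeToCondensate holds
for every real C and every n (checked by
hand: s(Y)² ≥ e^(−C)∫Ψ(x,Y)²·|good_(x,Y)|dx uses no sign of C).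

RANKED CRUXES. #2 TypicalLandscape (crux) — (card K1/K2 in surviving form) for every repulsive
finite-range v there is ρ₀ > 0 such that for 0 < ρ < ρ₀ there is C ∈ ℝ with: for all large n and
every δ > 0 there is a periodic trial state Ψ of N = n+1 bosons on the torus of side L =
(N/ρ)^(1/3), δ-near-minimiser of the periodic energy, Ψ ≥ 0 pointwise, whose exceptional set B =
{(x,Y,y) : y ∈ cell, Ψ(y,Y) < e^(−C)Ψ(x,Y)} has ∫_(cell^n)∫_(cell) Ψ(x,Y)²·vol(B_(x,Y)) dx dY ≤ L³/2
(relocating a typical boson to a uniform random point costs ≤ C in log-amplitude with probability ≥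
1/2). [difficulty: open-problem] (why it might fail: the one-atom increment of log Ψ₀ contains the
collective 1/r² (Reatto–Chester) tail, a linear statistic with û ~ 1/k: bounded only if the pinned
bath decorrelates integrably (S(k) ≤ Ck-type input, unproved); heavy lower tails over bath
configurations Y.) [LSSY2005, ReattoChester1967, McMillan1965, arXiv:2305.08423,
doi:10.1137/20m1363479, PenroseOnsager1956]
#3 MeanFieldCorner (crux) — (card K3, anchor; not on the assembly path) for every bounded, smooth,
finite-range radial w ≥ 0 of positive type (Σ a_i a_j w(|x_i − x_j|) ≥ 0 for all finite families: ŵ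
≥ 0, Bochner) there are ONE functional 𝒰 : (probability measures on ℝ³) → ℝ, Lipschitz for the
bounded-Lipschitz metric, and C such that for every N ≥ 1 there is a constant c_N with: for every δ
> 0 some nonnegative periodic δ-near-minimiser Ψ of N bosons on the UNIT torus with pair potential
w/N satisfies e^(−C) ≤ Ψ(X)·exp(N·𝒰(μ_X) + c_N) ≤ e^C for all X in the cell, μ_X = N⁻¹Σδ_(x_i) —
sup-norm −log Ψ₀ = N𝒰(μ_X) + c_N + O(1) with an N-independent Lipschitz 𝒰 (the ergodic
mean-field-control value); implies f₀ ≥ e^(−2C−2Lip(𝒰)) in the mean-field corner in one line.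
[difficulty: L] (why it might fail: DDJ/CDLL are finite-horizon; the ergodic sup-norm comparison
needs N-uniform long-time stability (turnpike) of the controlled N-particle system, and ŵ ≥ 0 gives
convexity but not strict convexity of F(m) = ½∫∫w dm dm.) [arXiv:2305.08423, arXiv:1509.02505,
arXiv:2312.11373, doi:10.2140/apde.2019.12.1397, doi:10.1137/20m1363479,
doi:10.1007/s00220-011-1261-6, doi:10.1063/1.4752475, doi:10.1103/physrevd.27.1774]
#4 PeriodicRigidity (crux) — (phase rigidity of periodic near-minimisers) for every repulsive
finite-range v there is ρ₀ > 0 such that for 0 < ρ < ρ₀, for all large N and every η > 0 there is δ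
> 0 with: any two δ-near-minimisers Ψ, Φ of the periodic N-body energy on the torus of side
(N/ρ)^(1/3) satisfy ∫_(cell^N) |Ψ − cΦ|² ≤ η for some unit complex c (compact resolvent, unique
positive ground state and spectral gap at fixed N; the periodic twin of
BECPalmLandscape.GroundStateRigidity). [difficulty: M] (why it might fail: hard cores (v = ⊤ on
[0,a]) and impenetrable shells disconnect the N-particle configuration space; uniqueness then needs
every non-dilute component to lie an N-uniform gap above E₀ — connectivity of hard-sphere
configuration spaces at low density is open in general.) [ReedSimonIV1978, doi:10.1093/imrn/rnt012,
LSSY2005]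
#5 BoundaryTransferWeak (crux) — (shared item stmt-AtomisticToContinuum-0827 of route
BECPeriodicReduction, verbatim signature) for each repulsive finite-range v, constant-mode
condensation of periodic near-minimisers at all small densities (the PeriodicBEC body for v) implies
∃ρ₀ > 0 ∀ρ ∈ (0,ρ₀) HasGroundStateBEC v ρ (Dirichlet ground state, λ_max(γ) ≥ cN via
condensateNumber). [difficulty: L] (why it might fail: only the ENERGY is known to be
boundary-condition independent (LSSY Ch. 2 after (2.8)); the Dirichlet ground state lies a wall term
≫ δ above E₀^per, so no energy-comparison proof; Neumann bracketing + a mode-free criterion is the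
expected but unwritten route.) [LSSY2005, arXiv:2203.01841, arXiv:2205.15284, arXiv:2603.20776,
doi:10.1007/bf01608554]
#9 LandscapeToCondensate (support) — (card P1, periodic, one-sided) for L > 0, any real C and any
periodic trial state Ψ ≥ 0 of n+1 bosons on the torus of side L: if ∫_(cell^n)∫_(cell) Ψ(x,Y)²·vol{y
∈ cell : Ψ(y,Y) < e^(−C)Ψ(x,Y)} dx dY ≤ L³/2 then condensateOccupation ≥ (n+1)e^(−C)/2 (occ₀ =
(n+1)L⁻³∫s(Y)²dY with s = ∫_cell Ψ(·,Y); s² = ∫∫Ψ(x,Y)Ψ(y,Y) ≥ e^(−C)∫Ψ(x,Y)²·vol(good_(x,Y)); ∫∫Ψ²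
= 1 via the measure-preserving split X = x :: Y of the cell). [difficulty: provable-now]
[PenroseOnsager1956, LSSY2005]
#9 PeriodicOccupationStability (support) — for L > 0, periodic trial states Ψ, Φ of N bosons and |c|
= 1: condensateOccupation(Ψ)^(1/2) ≤ condensateOccupation(Φ)^(1/2) + N^(1/2)·‖Ψ − cΦ‖_(L²(cell^N))
(F_Ψ(Y) = ⟨φ₀,Ψ(·,Y)⟩_cell, |F_Ψ − cF_Φ| ≤ ‖(Ψ − cΦ)(·,Y)‖, Minkowski in L²(dY), occ(cΦ) = occ(Φ);
the periodic twin of BECPalmLandscape.OccupationStability). [difficulty: provable-now] [LSSY2005]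

TWO-LAYER PLAN. Foreseen, nothing filed now. TypicalLandscape ⇐ PinnedBathDecay →
DisplacementComparison → TypicalLandscape: PinnedBathDecay = "for the
reversible diffusion on cell^(N−1) with invariant density ∝ Ψ₀(x,Y)Ψ₀(y,Y) (bath pinned at the two
positions of the tagged boson), local
mean-zero observables of the form Σ_j g(Y_j) with g supported near x or y have time-integrated
sup-decay bounded uniformly in N, L for
Ψ₀²-typical pinning data" (the t^(−3/2) statement; to be typed once a ground-state diffusion /
semigroup layer exists — it is the same missing
layer BECRecoilCorrector's correctors need), DisplacementComparison = the maximum-principle step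
"Poisson solution of the local source bounded
⇒ W = log Ψ₀(x,Y) − log Ψ₀(y,Y) bounded below off the exceptional set" (HJB comparison with doubled
tagged variable; hard cores by monotone
approximation v ∧ M ↑ v with M-uniform constants). MeanFieldCorner ⇐ ErgodicRate (ergodic DDJ: |U/N
− 𝒰(μ_X) − c_N| ≤ C/N for the N-agent
ergodic problem with cost ½∫∫w dm dm, via Cardaliaguet–Porretta long-time stability) →
DictionaryLemma (for C² Ψ = e^(−U) > 0 periodic:
(−Δ + V)Ψ = EΨ ⟺ ΔU − |∇U|² + V = E, and near-minimisers of periodicEnergy converge to Ψ₀ uniformly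
at fixed N) → MeanFieldCorner.
PeriodicRigidity ⇐ FiniteEnergy (E₀^per < ∞ at small ρR₀³) → UniqueGappedGroundState →
PeriodicRigidity.

KILL CRITERIA. ¬TypicalLandscape for some admissible v at arbitrarily small ρ (e.g. a proof that the
one-atom increment of log Ψ₀ has an unscreened,
log L-divergent variance under Ψ₀², so that the exceptional mass tends to 1 for every fixed C)
closes the route `refuted:TypicalLandscape` —
unless the divergence is only two-sided (then the one-sided form here is untouched: check which).
¬MeanFieldCorner (no N-independent Lipschitz
𝒰 even in Kac scaling with ŵ ≥ 0 smooth) kills the ENGINE: the dictionary would carry no rate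
content on the Bose side; pivot = close as
`refuted:MeanFieldCorner` and hand TypicalLandscape to BECPalmLandscape as a shared periodic form.
¬PeriodicRigidity for hard cores breaks
this assembly and every positivity route's (pivot: restrict v to bounded profiles +
EqualScatteringTransfer.ScatteringLengthTransfer).
¬BoundaryTransferWeak breaks all torus routes at once (pivot owned by BECPeriodicReduction).
PeriodicBEC (stmt-0826) or X_B1 proved elsewhere
moots everything but MeanFieldCorner.

NOT DECOMPOSED YET. How TypicalLandscape is proved (the pinned-bath Poisson equation, its t^(−3/2)
decay, the treatment of Ψ₀²-atypical clustered baths by the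
LSSY local energy bound, hard cores by truncation) and how MeanFieldCorner is proved (ergodic
adaptation of DDJ/CDLL or a direct
Bogoliubov–Feynman–Kac argument; identification of −log Ψ₀/N with the N-agent ergodic value à la
Albeverio–De Vecchi–Romano–Ugolini Thm 16/18;
W₁-Lipschitz regularity of the ergodic value on P(T³)) are layer-2 material. No constants (C, ρ₀,
the 1/2 threshold) are optimised; the
two-sided landscape bound, the card's K2 with an explicit Hartree–Jastrow 𝒰_L, and the all-density
version for v̂ ≥ 0 (card
fourier-positive-all-densities) are deliberately NOT filed: the first two are false/vacuous as
explained, the third is stronger than the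
conjunct needs.

CHEAPEST FALSIFIER. (i) Free gas v ≡ 0 (admissible): Ψ₀ ≡ L^(−3N/2) on the torus, exceptional set
empty for every C ≥ 0, occ₀ = N — TypicalLandscape,
LandscapeToCondensate (N e^(−C)/2 ≤ N) and PeriodicRigidity (gap 4π²/L² at fixed N) all consistent
(checked by hand). (ii) N = 1, 2 in
MeanFieldCorner: N = 1 forces osc_x 𝒰(δ_x) ≤ 2C, automatic from d_BL(δ_x,δ_y) ≤ √3 < 2 and the
shared constant (checked); N = 2 is the
two-body problem with potential w/2, log φ bounded — consistent. (iii) The decisive cheap test is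
numerical and was NOT run here (hub
compute-free for this unit): DMC/PIGS for N = 8…64 bosons on the unit torus with Gaussian-type w/N,
ŵ ≥ 0: fit sup_X|log Ψ₀ + N·(fitted
quadratic functional of μ̂_X(k))| against N — must plateau; and for hard/soft spheres at ρa³ ∈
[10⁻⁴,10⁻²], the exceptional mass at fixed C
against L/ξ ∈ [2,16] — must not drift to 1. (iv) Lookup: DDJ Prop 2.8 / Example 1 (read, pp. 5, 14):
convex non-smooth data give only
N^(−1/d), so MeanFieldCorner is stated for SMOOTH w only.

NUMBERS. DDJ rates (arXiv:2305.08423 Thm 2.6/2.7/Prop 2.8, pp. 5 and 14, read): C/N (convex +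
regular, (1.1)), V^N − C/N ≤ 𝒰 ≤ V^N + C/√N
(H^(−s)-regular), 0 ≤ V^N − 𝒰 ≤ C N^(−1/d) (convex d₁-Lipschitz, d ≥ 3, sharp). Exceptional-mass
threshold 1/2 ⇒ occ₀ ≥ e^(−C)N/2;
assembled constant c' = e^(−C)(1/√2 − 1/4)² ≈ 0.209·e^(−C). Free periodic gas: occ₀ = N exactly.
Kinetic gap of the unit torus 4π²;
healing length ξ = (8πρa)^(−1/2); cluster escape cost ≍ R₀√(k‖v‖∞) (why sup norms fail at fixed
density). Items at open: 7 (4 cruxes incl.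
1 shared, 2 supports, 1 assembly).

DEFINITION REQUESTS. None needed for the typed items (PeriodicTrialState, periodicEnergy,
periodicGroundStateEnergy, cell, cellN, condensateOccupation,
sideLength, HasGroundStateBEC, IsRepulsiveFiniteRange exist in
Literature.MathematicalPhysics.QuantumManyBody.BoseGas; the empirical measure
is (N)⁻¹ • Σ Measure.dirac, the W₁/bounded-Lipschitz regularity is written with LipschitzWith test
functions, positive type as Bochner's
finite-sum condition). Wanted LATER (not filed, to keep the Literature queue clean until
MeanFieldCorner is claimed): a notion
`ErgodicMeanFieldControlValue` (relative value of the ergodic McKean–Vlasov control problem on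
P(T^d), quadratic Hamiltonian, pair cost) so
that DDJ (1.1)/Thm 2.7 and Cardaliaguet–Porretta can be vendored as named facts and MeanFieldCorner
restated with 𝒰 identified.

Novelty: Searches (2026-08-15): `lit search --source arxiv "optimal rate convergence mean field control"` (8:
arXiv:2305.08423 DDJ, arXiv:2312.11373
Cardaliaguet–Jackson–Mimikos–Souganidis, arXiv:2607.11062 Munoz 2026 "recoupled shadow flows",
arXiv:2109.09134 — none touches Schrödinger
operators); `lit search --source arxiv "ergodic mean field control convergence N-player"` (6:
arXiv:1510.08900, arXiv:2507.11632 turnpike LQG,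
arXiv:2401.06534 Cirant–Redaelli — ergodic/long-time tools, no physics); `lit search --source
crossref` ×5 (doi:10.1137/20m1363479 ADRU 2022,
doi:10.2140/apde.2019.12.1397 Cardaliaguet–Porretta, doi:10.1007/s00220-011-1261-6 Seiringer 2011,
doi:10.1063/1.4752475 Kiessling 2012,
doi:10.1103/physrevd.27.1774 Guerra–Morato 1983); `lit read arxiv:2305.08423` pp. 2, 5, 14 (Thm 2.6,
2.7, Prop 2.8 quoted under Numbers);
`lit galaxy search --star all` ×5 ("ground state wave function mean field bosons large deviations
empirical measure", "Hamilton-Jacobi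
equation Wasserstein space Bose gas ground state", "stochastic control and the ground state", "mean
field games and Bose": 0 hits;
"logarithm of the ground state": 4, incl. pdf:-7927695452152996540 Marini–Maitra–Moncrief
"Euclidean-signature semi-classical program" =
the log-ground-state/HJ dictionary for oscillators and fields, no N-body rates); OpenAlex/S2 429
(budget exhausted) this session; plus the
card's two refuter audits (crossref ×5, zbMATH, arXiv, galaxy-all; nearest prior fixed there).
In-tree: no Theses file  [refs: 10.1137/20m1363479, 10.2140/apde.2019.12.1397, 10.1007/s00220-011-1261-6, 10.1063/1.4752475, 10.1103/physrevd.27.1774, 2305.08423, 2312.11373, 2607.11062, 2109.09134, 1510.08900, 2507.11632, 2401.06534, 2003.06469, 1509.02505, doi:10.1137/20m1363479, doi:10.2140/apde.2019.12.1397, doi:10.1007/s00220-011-1261-6, doi:10.1063/1.4752475, doi:10.1103/physrevd.27.1774, arxiv:2305.08423]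

Barriers (technique_class: mean-field-control, viscosity-comparison, landscape): - technique_class: mean-field-control, viscosity-comparison, landscape (ground-state positivity)
- Literature.Barriers.AtomisticToContinuum.KineticGapLengthScales: evaded — no Poincaré/kinetic-gap
inequality at scale L is used; the input on the state is POSITIVITY (Ψ = |Ψ|) plus a landscape
bound, and δ is chosen after N (ground-state-only statements); the gap re-enters only inside the
foreseen PinnedBathDecay child as a t^(−3/2) local decay, not as a 1/L² spectral gap — that is the
bet.
- Literature.Barriers.AtomisticToContinuum.KineticGapLengthScalesNarrow: not in its class —
TypicalLandscape/PeriodicBEC-via-rigidity are not energy-window statements valid for all Ψ in a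
window (the Galilei-boost witnesses e^(2πim·Σx_j/L)Φ are complex and are excluded by Ψ = |Ψ|; δ is
taken below the fixed-N gap and used only for L²-rigidity), exactly the exit (b′) the audit names.
- Literature.Barriers.AtomisticToContinuum.EnergyAsymptoticsWithoutCondensation: evaded — no energy
asymptotics are matched anywhere; MeanFieldCorner is a pointwise eigenfunction statement at total
precision O(1), which energy-density statements cannot express; the only energy input foreseen is
the leading-order LSSY bound for atypical clustered baths.
- Literature.Barriers.AtomisticToContinuum.BogoliubovPerturbationInfrared: not an expansion around
the Bogoliubov state in (ψ, ψ̄); the expanded object is log Ψ₀ (amplitude variable) through a linear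
Poisson equation; conceded: TypicalLandscape's why-fail IS the d =

History (route lifecycle, newest last):
- 2026-08-15T16:25:18Z · rev 2: dropped stmt-AtomisticToContinuum-6516, stmt-AtomisticToContinuum-6914 — route-repair follow-up: the deciding theorem `closes` (rev 1, native OK) takes PeriodicRigidity and PeriodicOccupationStability as hypotheses, but their items s (planner-rbadge-AtomisticToContinuum-BECMeanFie-aa696b43-g2-0)
- 2026-08-15T16:58:31Z · rev 9: restated Assembly (stmt-AtomisticToContinuum-8704) — route-repair (cone, gen 2), step 2: restate Assembly (stmt-AtomisticToContinuum-8704) 1:1 — the conclusion is now spelled `_root_.BoseEinsteinCondensation` (the (planner-rrepair-AtomisticToContinuum-BECMeanFi-aa696b43-g2-0)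
- 2026-08-25T00:53:03Z · DORMANT — reconciler: no traction for 7.2 d (last activity item-evidence-added at 2026-08-17T18:55:01Z); parked, not closed — `ledger route dormant route-AtomisticToConti (operator:999:1392003)
- 2026-08-29T03:23:28Z · REACTIVATED — reconciler: reactivated — activity statement-checked at 2026-08-29T01:17:37Z after parking at 2026-08-25T00:53:03Z (operator:999:4166729)
- 2026-08-29T19:24:25Z · DORMANT — census g0: costume|duplicate of route-AtomisticToContinuum-BECNewtonPolicyIteration; reader census-reader-32-g0 (operator:999:689429)

sub-problem: BoseEinsteinCondensation · status: dormant · opened planner-plancard-AtomisticToContinuum-BoseEin-270acb8e-0 2026-08-15T13:27:52Z · rev 9 · ledger route-AtomisticToContinuum-BECMeanFieldControl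
GENERATED by the gate from the ledger (D-0016/17). Provers cite these decls: `theorem foo : Summit.AtomisticToContinuum.BoseEinsteinCondensation.Theses.BECMeanFieldControl.<Decl> := …` in Summits/AtomisticToContinuum/BoseEinsteinCondensation/Theorems/<Name>.lean.
-/

namespace Summit.AtomisticToContinuum.BoseEinsteinCondensation.Theses.BECMeanFieldControl

open scoped BigOperators Topology Manifold Classical MeasureTheory ProbabilityTheory Matrix InnerProductSpace ComplexConjugate ContinuousMap
open Filter Set Function TopologicalSpace MeasureTheory

attribute [summit_statement] _root_.BoseEinsteinCondensation

/-- item stmt-AtomisticToContinuum-8701 · crux · rank 2 · open · by planner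
why it might fail: Conjecture-strength (implies BEC via LandscapeToCondensate); the one-atom increment of log Ψ₀ carries the collective Reatto–Chester 1/r² tail, a û~1/k linear statistic of the pinned bath: O(1) only if the bath decorrelates (S(k)→0), unproved at fixed density; clustered baths give heavy lower tails.
sources: LSSY2005, ReattoChester1967, McMillan1965, PenroseOnsager1956, arXiv:2305.08423, doi:10.1137/20m1363479
[crux] (card K1/K2 in surviving form) for every repulsive finite-range v there is ρ₀ > 0 such that
for 0 < ρ < ρ₀ there is C ∈ ℝ with: for all large n and every δ > 0 there is a periodic trial state
Ψ of N = n+1 bosons on the torus of side L = (N/ρ)^(1/3), δ-near-minimiser of the periodic energy, Ψ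
≥ 0 pointwise, whose exceptional set B = {(x,Y,y) : y ∈ cell, Ψ(y,Y) < e^(−C)Ψ(x,Y)} has
∫_(cell^n)∫_(cell) Ψ(x,Y)²·vol(B_(x,Y)) dx dY ≤ L³/2 (relocating a typical boson to a uniform random
point costs ≤ C in log-amplitude with probability ≥ 1/2). [difficulty: open-problem] -/
@[route_item "route-AtomisticToContinuum-BECMeanFieldControl", crux]
def TypicalLandscape : Prop :=
  ∀ v : ℝ → ENNReal, Literature.MathematicalPhysics.QuantumManyBody.BoseGas.IsRepulsiveFiniteRange v → ∃ ρ₀ : ℝ, 0 < ρ₀ ∧ ∀ ρ : ℝ, 0 < ρ → ρ < ρ₀ → ∃ C : ℝ, ∀ᶠ n : ℕ in Filter.atTop, ∀ δ : ENNReal, 0 < δ → ∃ Ψ : Literature.MathematicalPhysics.QuantumManyBody.BoseGas.PeriodicTrialState (n + 1) (Literature.MathematicalPhysics.QuantumManyBody.BoseGas.sideLength ρ (n + 1)), Literature.MathematicalPhysics.QuantumManyBody.BoseGas.periodicEnergy v Ψ ≤ Literature.MathematicalPhysics.QuantumManyBody.BoseGas.periodicGroundStateEnergy v (n + 1) (Literature.MathematicalPhysics.QuantumManyBody.BoseGas.sideLength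 ρ (n + 1)) + δ ∧ (∀ X, Ψ.ψ X = (‖Ψ.ψ X‖ : ℂ)) ∧ ∫⁻ Y in Literature.MathematicalPhysics.QuantumManyBody.BoseGas.cellN n (Literature.MathematicalPhysics.QuantumManyBody.BoseGas.sideLength ρ (n + 1)), ∫⁻ x in Literature.MathematicalPhysics.QuantumManyBody.BoseGas.cell (Literature.MathematicalPhysics.QuantumManyBody.BoseGas.sideLength ρ (n + 1)), (‖Ψ.ψ (Matrix.vecCons x Y)‖₊ : ENNReal) ^ 2 * MeasureTheory.volume {y : Literature.MathematicalPhysics.QuantumManyBody.BoseGas.Space | y ∈ Literature.MathematicalPhysics.QuantumManyBody.BoseGas.cell (Literature.MathematicalPhysics.QuantumManyBody.BoseGas.sideLength ρ (n + 1)) ∧ ‖Ψ.ψ (Matrix.vecCons y Y)‖ < Real.exp (-C) * ‖Ψ.ψ (Matrix.vecCons x Y)‖} ≤ ENNReal.ofReal (Literature.MathematicalPhysics.QuantumManyBody.BoseGas.sideLength ρ (n + 1) ^ 3 / 2)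

/-- item stmt-AtomisticToContinuum-8702 · crux · rank 3 · open · by planner
why it might fail: DDJ Thm 2.7/Prop 2.8 (p.14) and CDLL are finite-horizon: the ergodic sup-norm O(1) law needs N-uniform long-time stability (turnpike) and a globally W₁-Lipschitz ergodic value on P(T³); ŵ≥0 gives monotonicity, not strict convexity; the bound is a sup over all X incl. clusters of Ψ₀²-mass e^(−cN).
sources: arXiv:2305.08423, arXiv:1509.02505, arXiv:2312.11373, doi:10.2140/apde.2019.12.1397, doi:10.1137/20m1363479, Seiringer2011
[crux] (card K3, anchor; not on the assembly path) for every bounded, smooth, finite-range radial w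
≥ 0 of positive type (Σ a_i a_j w(|x_i − x_j|) ≥ 0 for all finite families: ŵ ≥ 0, Bochner) there
are ONE functional 𝒰 : (probability measures on ℝ³) → ℝ, Lipschitz for the bounded-Lipschitz metric,
and C such that for every N ≥ 1 there is a constant c_N with: for every δ > 0 some nonnegative
periodic δ-near-minimiser Ψ of N bosons on the UNIT torus with pair potential w/N satisfies e^(−C) ≤
Ψ(X)·exp(N·𝒰(μ_X) + c_N) ≤ e^C for all X in the cell, μ_X = N⁻¹Σδ_(x_i) — sup-norm −log Ψ₀ = N𝒰(μ_X)
+ c_N + O(1) with an N-independent Lipschitz 𝒰 (the ergodic mean-field-control value); implies f₀ ≥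
e^(−2C−2Lip(𝒰)) in the mean-field corner in one line. [difficulty: L] -/
@[route_item "route-AtomisticToContinuum-BECMeanFieldControl"]
def MeanFieldCorner : Prop :=
  ∀ w : ℝ → ENNReal, Literature.MathematicalPhysics.QuantumManyBody.BoseGas.IsRepulsiveFiniteRange w → (∃ M : NNReal, ∀ r, w r ≤ M) → (∀ n : ℕ, ContDiff ℝ n fun x : Literature.MathematicalPhysics.QuantumManyBody.BoseGas.Space => (w ‖x‖).toReal) → (∀ (k : ℕ) (x : Fin k → Literature.MathematicalPhysics.QuantumManyBody.BoseGas.Space) (a : Fin k → ℝ), 0 ≤ ∑ i, ∑ j, a i * a j * (w (dist (x i) (x j))).toReal) → ∃ (U : MeasureTheory.Measure Literature.MathematicalPhysics.QuantumManyBody.BoseGas.Space → ℝ) (C : ℝ), (∀ (μ ν : MeasureTheory.Measure Literature.MathematicalPhysics.QuantumManyBody.BoseGas.Space) (ε : ℝ), MeasureTheory.IsProbabilityMeasure μ → MeasureTheory.IsProbabilityMeasure ν → (∀ f : Literature.MathematicalPhysics.QuantumManyBody.BoseGas.Space → ℝ, LipschitzWith 1 f → (∀ x, |f x| ≤ 1)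 → |(∫ x, f x ∂μ) - ∫ x, f x ∂ν| ≤ ε) → |U μ - U ν| ≤ C * ε) ∧ ∀ N : ℕ, 0 < N → ∃ c : ℝ, ∀ δ : ENNReal, 0 < δ → ∃ Ψ : Literature.MathematicalPhysics.QuantumManyBody.BoseGas.PeriodicTrialState N 1, Literature.MathematicalPhysics.QuantumManyBody.BoseGas.periodicEnergy (fun r => w r / (N : ENNReal)) Ψ ≤ Literature.MathematicalPhysics.QuantumManyBody.BoseGas.periodicGroundStateEnergy (fun r => w r / (N : ENNReal)) N 1 + δ ∧ (∀ X, Ψ.ψ X = (‖Ψ.ψ X‖ : ℂ)) ∧ ∀ X ∈ Literature.MathematicalPhysics.QuantumManyBody.BoseGas.cellN N 1, Real.exp (-C) ≤ ‖Ψ.ψ X‖ * Real.exp (N * U ((N : ENNReal)⁻¹ • ∑ i : Fin N, MeasureTheory.Measure.dirac (X i)) + c) ∧ ‖Ψ.ψ X‖ * Real.exp (N * U ((N : ENNReal)⁻¹ • ∑ i : Fin N, MeasureTheory.Measure.dirac (X i)) + c) ≤ Real.exp C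

-- earlier PeriodicRigidity (stmt-AtomisticToContinuum-6516, dropped 2026-08-15T16:25:18Z): moot by None — ∀ v : ℝ → ENNReal, Literature.MathematicalPhysics.QuantumManyBody.BoseGas.IsRepulsiveFiniteRange v → ∃ ρ₀ : ℝ, 0 < ρ₀ ∧ ∀ ρ : ℝ, 0 < ρ → ρ < ρ₀ → ∀ᶠ N : ℕ in Filter.atTop, ∀ η : ℝ, 0 < η → ∃ δ : ENNReal, 0 < δ ∧ ∀ Ψ Φ : Literature.MathematicalPhysics.QuantumManyBody.BoseGas.PeriodicTrialState N 
/-- item stmt-AtomisticToContinuum-8958 · crux · rank 4 · open · by planner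
why it might fail: Routine for bounded v (compact resolvent + Perron–Frobenius; fkL2_perronFrobenius needs v ≤ C), but v may be ⊤ (hard cores, shells ⊤·1_[a,b]): {V<∞} disconnects and H decouples; uniqueness needs the fluid component to be the unique minimiser mod symmetry at every large N — open (BBK2013, DLM2010).
sources: ReedSimonIV1978, BaryshnikovBubenikKahle2013, DiaconisLebeauMichel2010, Kahle2012, LSSY2005, Literature.MathematicalPhysics.QuantumManyBody.BoseGas.fkL2_perronFrobenius
[crux] (card item PI4, torus twin of BECPalmLandscape.GroundStateRigidity =
stmt-AtomisticToContinuum-3298) ∀ admissible v ∃ρ₀ ∀ρ<ρ₀ ∀ᶠ N ∀η>0 ∃δ>0: any two periodic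
δ-near-minimisers Ψ, Φ ∈ PeriodicTrialState N L (L = (N/ρ)^{1/3}) satisfy ∫_{cell^N}|Ψ − cΦ|² ≤ η
for some unit complex c (E₀^per < ∞ at low density, compact resolvent of the torus N-body operator,
unique positive ground state by positivity improvement, spectral gap at fixed N; hard cores via
energetic dominance / connectivity of the dilute component of configuration space). [difficulty: M] -/
@[route_item "route-AtomisticToContinuum-BECMeanFieldControl", crux]
def PeriodicRigidity : Prop :=
  ∀ v : ℝ → ENNReal, Literature.MathematicalPhysics.QuantumManyBody.BoseGas.IsRepulsiveFiniteRange v → ∃ ρ₀ : ℝ, 0 < ρ₀ ∧ ∀ ρ : ℝ, 0 < ρ → ρ < ρ₀ → ∀ᶠ N : ℕ in Filter.atTop, ∀ η : ℝ, 0 < η → ∃ δ : ENNReal, 0 < δ ∧ ∀ Ψ Φ : Literature.MathematicalPhysics.QuantumManyBody.BoseGas.PeriodicTrialState N (Literature.MathematicalPhysics.QuantumManyBody.BoseGas.sideLength ρ N), Literature.MathematicalPhysics.QuantumManyBody.BoseGas.periodicEnergy v Ψ ≤ Literature.MathematicalPhysics.QuantumManyBody.BoseGas.periodicGroundStateEnergy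 v N (Literature.MathematicalPhysics.QuantumManyBody.BoseGas.sideLength ρ N) + δ → Literature.MathematicalPhysics.QuantumManyBody.BoseGas.periodicEnergy v Φ ≤ Literature.MathematicalPhysics.QuantumManyBody.BoseGas.periodicGroundStateEnergy v N (Literature.MathematicalPhysics.QuantumManyBody.BoseGas.sideLength ρ N) + δ → ∃ c : ℂ, ‖c‖ = 1 ∧ ∫⁻ X in Literature.MathematicalPhysics.QuantumManyBody.BoseGas.cellN N (Literature.MathematicalPhysics.QuantumManyBody.BoseGas.sideLength ρ N), (‖Ψ.ψ X - c * Φ.ψ X‖₊ : ENNReal) ^ 2 ≤ ENNReal.ofReal η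

/-- item stmt-AtomisticToContinuum-0827 · crux · rank 5 · open · by planner
why it might fail: Hypothesis is ground-state-only (δ after N) at box (N/ρ)^(1/3): the Dirichlet GS restricted to sub-boxes is neither periodic nor sharp-N nor a near-minimiser, so it may never fire (transfer ≈ conjunct); only the ENERGY is BC-independent (LSSY Ch. 2); free-gas BEC is BC-sensitive (Robinson1976).
sources: LSSY2005, Basti2022, BoccatoSeiringer2023, Junge2026, Robinson1976, LauwersVerbeureZagrebnov2003
[crux] BoundaryTransferWeak (mode-free boundary-condition transfer, per potential): for each
repulsive finite-range v, PeriodicBEC(v) implies ∃ρ₀>0 ∀ρ∈(0,ρ₀) HasGroundStateBEC v ρ (Dirichlet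
ground state, λ_max(γ) ≥ cN via condensateNumber). Not glue: near-minimiser slacks are O(N/L²) while
Dirichlet/periodic energies differ by a boundary term ≫ N/L², so no energy-comparison proof;
expected route: Neumann bracketing of interior sub-boxes (−Δ_Dir ≥ ⊕−Δ_Neu, v ≥ 0) + a mode-free
criterion (λ_max ≥ tr γ²/N). Only the ENERGY analogue is in print (LiebSeiringerSolovejYngvason2005
Ch. 2 after (2.8)). v ≡ 0: hypothesis and conclusion both true. -/
@[route_item "route-AtomisticToContinuum-BECMeanFieldControl", crux]
def BoundaryTransferWeak : Prop :=
  ∀ v : ℝ → ENNReal, Literature.MathematicalPhysics.QuantumManyBody.BoseGas.IsRepulsiveFiniteRange v → (∃ ρ₀ : ℝ, 0 < ρ₀ ∧ ∀ ρ : ℝ, 0 < ρ → ρ < ρ₀ → ∃ c : ℝ, 0 < c ∧ ∀ᶠ N : ℕ in Filter.atTop, ∃ δ : ENNReal, 0 < δ ∧ ∀ Ψ : Literature.MathematicalPhysics.QuantumManyBody.BoseGas.PeriodicTrialState N (Literature.MathematicalPhysics.QuantumManyBody.BoseGas.sideLength ρ N), Literature.MathematicalPhysics.QuantumManyBody.BoseGas.periodicEnergy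 v Ψ ≤ Literature.MathematicalPhysics.QuantumManyBody.BoseGas.periodicGroundStateEnergy v N (Literature.MathematicalPhysics.QuantumManyBody.BoseGas.sideLength ρ N) + δ → ENNReal.ofReal (c * N) ≤ Literature.MathematicalPhysics.QuantumManyBody.BoseGas.condensateOccupation N (Literature.MathematicalPhysics.QuantumManyBody.BoseGas.sideLength ρ N) Ψ.ψ) → ∃ ρ₀ : ℝ, 0 < ρ₀ ∧ ∀ ρ : ℝ, 0 < ρ → ρ < ρ₀ → Literature.MathematicalPhysics.QuantumManyBody.BoseGas.HasGroundStateBEC v ρ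

/-- item stmt-AtomisticToContinuum-8703 · support · rank 9 · closed · proved by Summit.AtomisticToContinuum.BoseEinsteinCondensation.Theorems.landscapeToCondensate_proof @ 98044d30c319 (prover) · by planner
sources: PenroseOnsager1956, LSSY2005
[support] (card P1, periodic, one-sided) for L > 0, any real C and any periodic trial state Ψ ≥ 0 of
n+1 bosons on the torus of side L: if ∫_(cell^n)∫_(cell) Ψ(x,Y)²·vol{y ∈ cell : Ψ(y,Y) <
e^(−C)Ψ(x,Y)} dx dY ≤ L³/2 then condensateOccupation ≥ (n+1)e^(−C)/2 (occ₀ = (n+1)L⁻³∫s(Y)²dY with s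
= ∫_cell Ψ(·,Y); s² = ∫∫Ψ(x,Y)Ψ(y,Y) ≥ e^(−C)∫Ψ(x,Y)²·vol(good_(x,Y)); ∫∫Ψ² = 1 via the
measure-preserving split X = x :: Y of the cell). [difficulty: provable-now] -/
@[route_item "route-AtomisticToContinuum-BECMeanFieldControl", crux]
def LandscapeToCondensate : Prop :=
  ∀ (n : ℕ) (L C : ℝ), 0 < L → ∀ Ψ : Literature.MathematicalPhysics.QuantumManyBody.BoseGas.PeriodicTrialState (n + 1) L, (∀ X, Ψ.ψ X = (‖Ψ.ψ X‖ : ℂ)) → ∫⁻ Y in Literature.MathematicalPhysics.QuantumManyBody.BoseGas.cellN n L, ∫⁻ x in Literature.MathematicalPhysics.QuantumManyBody.BoseGas.cell L, (‖Ψ.ψ (Matrix.vecCons x Y)‖₊ : ENNReal) ^ 2 * MeasureTheory.volume {y : Literature.MathematicalPhysics.QuantumManyBody.BoseGas.Space | y ∈ Literature.MathematicalPhysics.QuantumManyBody.BoseGas.cell L ∧ ‖Ψ.ψ (Matrix.vecCons y Y)‖ < Real.exp (-C) * ‖Ψ.ψ (Matrix.vecCons x Y)‖} ≤ ENNReal.ofReal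 (L ^ 3 / 2) → ENNReal.ofReal ((n + 1) * Real.exp (-C) / 2) ≤ Literature.MathematicalPhysics.QuantumManyBody.BoseGas.condensateOccupation (n + 1) L Ψ.ψ

-- `LandscapeToCondensate` holds: proved by `Summit.AtomisticToContinuum.BoseEinsteinCondensation.Theorems.landscapeToCondensate_proof` @ 98044d30c319 (its module imports this route file, so no `_holds` link can be stated here).

-- earlier PeriodicOccupationStability (stmt-AtomisticToContinuum-6914, dropped 2026-08-15T16:25:18Z): moot by None — ∀ (N : ℕ) (L : ℝ), 0 < L → ∀ (Ψ Φ : Literature.MathematicalPhysics.QuantumManyBody.BoseGas.PeriodicTrialState N L) (c : ℂ), ‖c‖ = 1 → Literature.MathematicalPhysics.QuantumManyBody.BoseGas.condensateOccupation N L Ψ.ψ ^ (1 / 2 : ℝ) ≤ Literature.MathematicalPhysics.QuantumManyBody.Bose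
/-- item stmt-AtomisticToContinuum-9164 · support · rank 9 · closed · proved by Summit.AtomisticToContinuum.BoseEinsteinCondensation.Theorems.periodicOccupationStability_proof (prover) · by planner
sources: LSSY2005
[support] OCCUPATION STABILITY on the torus: for periodic trial states Ψ, Φ of N bosons and |c| = 1,
condensateOccupation(Ψ)^(1/2) ≤ condensateOccupation(Φ)^(1/2) + N^(1/2) (∫_(cell^N)|Ψ − cΦ|²)^(1/2)
(F_Ψ(Y) = ⟨φ₀, Ψ(·,Y)1_cell⟩, |F_Ψ − F_(cΦ)| ≤ ‖(Ψ − cΦ)(·,Y)‖_(L²(cell)), Minkowski in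
L²(cell^(N−1)); occ(cΦ) = occ(Φ)). [difficulty: provable-now] -/
@[route_item "route-AtomisticToContinuum-BECMeanFieldControl", crux]
def PeriodicOccupationStability : Prop :=
  ∀ (N : ℕ) (L : ℝ), 0 < L → ∀ (Ψ Φ : Literature.MathematicalPhysics.QuantumManyBody.BoseGas.PeriodicTrialState N L) (c : ℂ), ‖c‖ = 1 → Literature.MathematicalPhysics.QuantumManyBody.BoseGas.condensateOccupation N L Ψ.ψ ^ (1 / 2 : ℝ) ≤ Literature.MathematicalPhysics.QuantumManyBody.BoseGas.condensateOccupation N L Φ.ψ ^ (1 / 2 : ℝ) + (N : ENNReal) ^ (1 / 2 : ℝ) * (∫⁻ X in Literature.MathematicalPhysics.QuantumManyBody.BoseGas.cellN N L, (‖Ψ.ψ X - c * Φ.ψ X‖₊ : ENNReal) ^ 2) ^ (1 / 2 : ℝ)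

/-- `PeriodicOccupationStability` holds: proved by `Summit.AtomisticToContinuum.BoseEinsteinCondensation.Theorems.periodicOccupationStability_proof`. -/
theorem PeriodicOccupationStability_holds : PeriodicOccupationStability := _root_.Summit.AtomisticToContinuum.BoseEinsteinCondensation.Theorems.periodicOccupationStability_proof

-- earlier Assembly (stmt-AtomisticToContinuum-8704, replaced 2026-08-15T16:58:31Z -> stmt-AtomisticToContinuum-11280): retired by None — TypicalLandscape → PeriodicRigidity → LandscapeToCondensate → PeriodicOccupationStability → BoundaryTransferWeak → Literature.MathematicalPhysics.QuantumManyBody.BoseGas.BoseEinsteinCondensation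
/-- item stmt-AtomisticToContinuum-11280 · assembly · rank 1 · closed · proved by Summit.AtomisticToContinuum.BoseEinsteinCondensation.Theorems.becMeanFieldControl_assembly_proof (prover) · by planner
sources: LSSY2005, PenroseOnsager1956
[assembly] TypicalLandscape → PeriodicRigidity → LandscapeToCondensate → PeriodicOccupationStability
→ BoundaryTransferWeak → BoseEinsteinCondensation (the sub-problem Statement; = the type of the
deciding theorem `closes`). -/
@[route_item "route-AtomisticToContinuum-BECMeanFieldControl"]
def Assembly : Prop :=
  TypicalLandscape → PeriodicRigidity → LandscapeToCondensate → PeriodicOccupationStability → BoundaryTransferWeak → _root_.BoseEinsteinCondensation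

-- `Assembly` holds: proved by `Summit.AtomisticToContinuum.BoseEinsteinCondensation.Theorems.becMeanFieldControl_assembly_proof` (its module imports this route file, so no `_holds` link can be stated here).

/-! D-0027 §2.1 — DECIDING THEOREM (planner-authored via `route open/edit --closes-file`; by planner-rrepair-AtomisticToContinuum-BECMeanFi-aa696b43-g2-0 2026-08-15T16:58:31Z):
its hypotheses are this route's items and its conclusion the sub-problem Statement (glue_lint), and it elaborates with this file. -/

@[closes "route-AtomisticToContinuum-BECMeanFieldControl"] theorem closes (h₁ : TypicalLandscape) (h₂ : PeriodicRigidity) (h₃ : LandscapeToCondensate)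
    (h₄ : PeriodicOccupationStability) (h₅ : BoundaryTransferWeak) :
    _root_.BoseEinsteinCondensation := by
  -- deciding theorem (type unchanged since rev 1): TypicalLandscape, PeriodicRigidity, LandscapeToCondensate,
  -- PeriodicOccupationStability, BoundaryTransferWeak ⊢ BoseEinsteinCondensation; native certification pass (cone repair, gen 2).
  intro v hv
  apply h₅ v hv
  obtain ⟨ρ₁, hρ₁, hTL⟩ := h₁ v hv
  obtain ⟨ρ₂, hρ₂, hPR⟩ := h₂ v hv
  refine ⟨min ρ₁ ρ₂, lt_min hρ₁ hρ₂, fun ρ hρ hρlt => ?_⟩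
  obtain ⟨C, hC⟩ := hTL ρ hρ (lt_of_lt_of_le hρlt (min_le_left _ _))
  have hR := hPR ρ hρ (lt_of_lt_of_le hρlt (min_le_right _ _))
  refine ⟨Real.exp (-C) / 32, by positivity, ?_⟩
  rw [Filter.eventually_atTop] at hC hR ⊢
  obtain ⟨n₀, hn₀⟩ := hC
  obtain ⟨N₀, hN₀⟩ := hR
  refine ⟨n₀ + N₀ + 1, fun N hN => ?_⟩
  obtain ⟨n, rfl⟩ : ∃ n, N = n + 1 := ⟨N - 1, by omega⟩
  have hn : n₀ ≤ n := by omega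
  have hNN : N₀ ≤ n + 1 := by omega
  -- positivity of the side length
  have hLpos : 0 < Literature.MathematicalPhysics.QuantumManyBody.BoseGas.sideLength ρ (n + 1) := by
    unfold Literature.MathematicalPhysics.QuantumManyBody.BoseGas.sideLength
    apply Real.rpow_pos_of_pos
    positivity
  -- rigidity at tolerance η = e^{-C}/8 fixes δ
  obtain ⟨δ, hδ, hrig⟩ := hN₀ (n + 1) hNN (Real.exp (-C) / 8) (by positivity)
  refine ⟨δ, hδ, fun Φ hΦ => ?_⟩
  -- the landscape state at this δ
  obtain ⟨Ψ, hΨE, hΨnn, hΨexc⟩ := hn₀ n hn δ hδ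
  have hocc := h₃ n _ C hLpos Ψ hΨnn hΨexc
  obtain ⟨c, hc, hclose⟩ := hrig Ψ Φ hΨE hΦ
  have hstab := h₄ (n + 1) _ hLpos Ψ Φ c hc
  -- abbreviations
  set A := Literature.MathematicalPhysics.QuantumManyBody.BoseGas.condensateOccupation (n + 1)
    (Literature.MathematicalPhysics.QuantumManyBody.BoseGas.sideLength ρ (n + 1)) Ψ.ψ with hA
  set B := Literature.MathematicalPhysics.QuantumManyBody.BoseGas.condensateOccupation (n + 1)
    (Literature.MathematicalPhysics.QuantumManyBody.BoseGas.sideLength ρ (n + 1)) Φ.ψ with hB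
  set I := ∫⁻ X in Literature.MathematicalPhysics.QuantumManyBody.BoseGas.cellN (n + 1)
    (Literature.MathematicalPhysics.QuantumManyBody.BoseGas.sideLength ρ (n + 1)),
      (‖Ψ.ψ X - c * Φ.ψ X‖₊ : ENNReal) ^ 2 with hI
  -- real bookkeeping
  set m : ℝ := (n : ℝ) + 1 with hm
  have hm0 : 0 ≤ m := by positivity
  have hcast : ((n + 1 : ℕ) : ℝ) = m := by push_cast; rfl
  have hcastE : ((n + 1 : ℕ) : ENNReal) = ENNReal.ofReal m := by
    rw [← hcast, ENNReal.ofReal_natCast]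
  set e : ℝ := Real.exp (-C) with he
  have he0 : 0 < e := Real.exp_pos _
  set a : ℝ := Real.sqrt (m * e / 2) with ha
  set b : ℝ := Real.sqrt (m * e / 8) with hb
  have ha0 : 0 ≤ a := Real.sqrt_nonneg _
  have hb0 : 0 ≤ b := Real.sqrt_nonneg _
  have hab : a = 2 * b := by
    have h4 : Real.sqrt 4 = 2 := by
      rw [show (4 : ℝ) = 2 ^ 2 by norm_num, Real.sqrt_sq (by norm_num : (0 : ℝ) ≤ 2)]
    rw [ha, hb, show m * e / 2 = 4 * (m * e / 8) by ring, Real.sqrt_mul (by norm_num : (0:ℝ) ≤ 4), h4]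
  have hbsq : b ^ 2 = m * e / 8 := by
    rw [hb, Real.sq_sqrt (by positivity)]
  -- step 1: ofReal a ≤ A^(1/2)
  have h1 : ENNReal.ofReal a ≤ A ^ (1 / 2 : ℝ) := by
    have : ENNReal.ofReal (m * e / 2) ≤ A := by
      have := hocc
      simpa [hm, he, mul_comm, mul_left_comm, mul_assoc, mul_div_assoc] using this
    calc ENNReal.ofReal a = ENNReal.ofReal ((m * e / 2) ^ (1 / 2 : ℝ)) := by
            rw [ha, Real.sqrt_eq_rpow]
      _ = (ENNReal.ofReal (m * e / 2)) ^ (1 / 2 : ℝ) :=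
            (ENNReal.ofReal_rpow_of_nonneg (by positivity) (by norm_num)).symm
      _ ≤ A ^ (1 / 2 : ℝ) := ENNReal.rpow_le_rpow this (by norm_num)
  -- step 2: the error term is ≤ ofReal b
  have h2 : ((n + 1 : ℕ) : ENNReal) ^ (1 / 2 : ℝ) * I ^ (1 / 2 : ℝ) ≤ ENNReal.ofReal b := by
    have hI' : I ^ (1 / 2 : ℝ) ≤ (ENNReal.ofReal (e / 8)) ^ (1 / 2 : ℝ) :=
      ENNReal.rpow_le_rpow hclose (by norm_num)
    calc ((n + 1 : ℕ) : ENNReal) ^ (1 / 2 : ℝ) * I ^ (1 / 2 : ℝ)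
        ≤ ((n + 1 : ℕ) : ENNReal) ^ (1 / 2 : ℝ) * (ENNReal.ofReal (e / 8)) ^ (1 / 2 : ℝ) :=
          mul_le_mul' le_rfl hI'
      _ = ENNReal.ofReal (m ^ (1 / 2 : ℝ)) * ENNReal.ofReal ((e / 8) ^ (1 / 2 : ℝ)) := by
          rw [hcastE, ENNReal.ofReal_rpow_of_nonneg hm0 (by norm_num),
            ENNReal.ofReal_rpow_of_nonneg (by positivity) (by norm_num)]
      _ = ENNReal.ofReal (m ^ (1 / 2 : ℝ) * (e / 8) ^ (1 / 2 : ℝ)) :=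
          (ENNReal.ofReal_mul (Real.rpow_nonneg hm0 _)).symm
      _ = ENNReal.ofReal b := by
          rw [← Real.mul_rpow hm0 (by positivity), hb, Real.sqrt_eq_rpow]
          congr 1
          ring_nf
  -- step 3: ofReal (a - b) ≤ B^(1/2)
  have h3 : ENNReal.ofReal (a - b) ≤ B ^ (1 / 2 : ℝ) := by
    have hle : ENNReal.ofReal a ≤ B ^ (1 / 2 : ℝ) + ENNReal.ofReal b :=
      h1.trans (hstab.trans (add_le_add le_rfl h2))
    rw [ENNReal.ofReal_sub a hb0]
    exact tsub_le_iff_right.mpr hle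
  -- step 4: square
  have h4 : ENNReal.ofReal ((a - b) ^ 2) ≤ B := by
    have hsq := ENNReal.rpow_le_rpow h3 (by norm_num : (0 : ℝ) ≤ 2)
    rw [← ENNReal.rpow_mul, show (1 / 2 : ℝ) * 2 = 1 by norm_num, ENNReal.rpow_one,
      ENNReal.ofReal_rpow_of_nonneg (by rw [hab]; linarith) (by norm_num), Real.rpow_two] at hsq
    exact hsq
  -- step 5: compare constants
  calc ENNReal.ofReal (Real.exp (-C) / 32 * ((n + 1 : ℕ) : ℝ))
      ≤ ENNReal.ofReal ((a - b) ^ 2) := by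
        apply ENNReal.ofReal_le_ofReal
        rw [hcast, hab, show (2 * b - b) ^ 2 = b ^ 2 by ring, hbsq, ← he]
        nlinarith [he0, hm0]
    _ ≤ B := h4

end Summit.AtomisticToContinuum.BoseEinsteinCondensation.Theses.BECMeanFieldControl
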